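import Mathlib

/-!
# Route `SymPencil` — inner rank of the `2 | 2` row split of `per_4`, PEELED case: lemmas for the
# flattening-rank lemma F5 (`--supports` stmt-ValiantsHypothesis-5674 `SdcSuperquadratic`; (8,8)
# column, memo `NOTE-p6g16-5674-R2-peeled-ten.md` §3)

Pure linear algebra over a field (no project imports), `4 × 4` matrices:
* `outer_indep` — `x ⊗ y`, `x' ⊗ y'` are independent when `x, x'` are and `y, y' ≠ 0`;
* `finrank_le_three_of_mulVec_eq_zero` — symmetric zero-diagonal matrices killing a fixed non-zero
  vector span at most `3` dimensions;
* `exists_indep_cols` — if `X w, X w'` are independent, `X` has two independent columns;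
* `six_le_finrank_szd`, `ten_le_finrank_da` — the symmetric zero-diagonal matrices span `≥ 6`
  dimensions, the matrices with antisymmetric off-diagonal part `≥ 10`.
Consumed by `…PeeledFlatRank.no_rank_four_factor`.  Honest framing: helper lemmas; no cell closes
here; `27 ≤ sdc(per_4) ≤ 29`, the crux and `VP ≠ VNP` untouched.  No definitions, no named facts.
[folklore]
-/

noncomputable section

-- single-conjunct layout: Sub = Summit, duplicated namespace component intended
set_option linter.dupNamespace false

namespace Summit.ValiantsHypothesis.ValiantsHypothesis.Theorems.SymPencilPerFourPeeledFlatRankLemmas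

open Matrix Finset Module

variable {K : Type*} [Field K]

/-- Two outer products `x ⊗ y`, `x' ⊗ y'` with `x, x'` independent and `y, y' ≠ 0` are linearly
independent. [folklore] -/
theorem outer_indep (x x' y y' : Fin 4 → K) (hx : LinearIndependent K ![x, x'])
    (hy : y ≠ 0) (hy' : y' ≠ 0) :
    ∀ s t : K, s • vecMulVec x y + t • vecMulVec x' y' = 0 → s = 0 ∧ t = 0 := by
  intro s t hst
  rw [LinearIndependent.pair_iff] at hx
  have col : ∀ l, (s * y l) • x + (t * y' l) • x' = 0 := by
    intro l; funext a
    have := congrFun (congrFun hst a) l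
    simp only [Matrix.add_apply, Matrix.smul_apply, vecMulVec_apply, smul_eq_mul,
      Matrix.zero_apply] at this
    simp only [Pi.add_apply, Pi.smul_apply, smul_eq_mul, Pi.zero_apply]
    linear_combination this
  obtain ⟨l, hl⟩ := Function.ne_iff.1 hy
  obtain ⟨l', hl'⟩ := Function.ne_iff.1 hy'
  have h1 := hx _ _ (col l)
  have h2 := hx _ _ (col l')
  exact ⟨(mul_eq_zero.1 h1.1).resolve_right hl, (mul_eq_zero.1 h2.2).resolve_right hl'⟩

/-- A space of symmetric zero-diagonal `4 × 4` matrices all killing a fixed non-zero vector has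
dimension at most `3`. [folklore] -/
theorem finrank_le_three_of_mulVec_eq_zero (v : Fin 4 → K) (hv : v ≠ 0)
    (P : Submodule K (Matrix (Fin 4) (Fin 4) K))
    (hP : ∀ T ∈ P, Tᵀ = T ∧ (∀ i, T i i = 0) ∧ T *ᵥ v = 0) : finrank K P ≤ 3 := by
  obtain ⟨i₀, hi₀⟩ := Function.ne_iff.1 hv
  fin_cases i₀
  · -- `v 0 ≠ 0`: the entries `T 1 2, T 1 3, T 2 3` determine `T`
    let f : P →ₗ[K] (Fin 3 → K) :=
      { toFun := fun T => ![(T : Matrix (Fin 4) (Fin 4) K) 1 2, (T : Matrix (Fin 4) (Fin 4) K) 1 3, (T : Matrix (Fin 4) (Fin 4) K) 2 3]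
        map_add' := fun T T' => by ext i; fin_cases i <;> simp
        map_smul' := fun s T => by ext i; fin_cases i <;> simp }
    have hf : Function.Injective f := by
      rw [← LinearMap.ker_eq_bot, LinearMap.ker_eq_bot']
      intro T hT
      obtain ⟨hs, hd, hTv⟩ := hP T T.2
      have e12 : (T : Matrix (Fin 4) (Fin 4) K) 1 2 = 0 := by
        have := congrFun hT 0; simpa [f] using this
      have e13 : (T : Matrix (Fin 4) (Fin 4) K) 1 3 = 0 := by
        have := congrFun hT 1; simpa [f] using this
      have e23 : (T : Matrix (Fin 4) (Fin 4) K) 2 3 = 0 := by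
        have := congrFun hT 2; simpa [f] using this
      have sy : ∀ i j, (T : Matrix (Fin 4) (Fin 4) K) i j = (T : Matrix (Fin 4) (Fin 4) K) j i :=
        fun i j => by have := congrFun (congrFun hs j) i; simpa only [transpose_apply] using this
      have e21 : (T : Matrix (Fin 4) (Fin 4) K) 2 1 = 0 := by rw [sy]; exact e12
      have e31 : (T : Matrix (Fin 4) (Fin 4) K) 3 1 = 0 := by rw [sy]; exact e13
      have e32 : (T : Matrix (Fin 4) (Fin 4) K) 3 2 = 0 := by rw [sy]; exact e23
      have r1 : (T : Matrix (Fin 4) (Fin 4) K) 1 0 = 0 := by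
        have := congrFun hTv 1
        simp only [mulVec, dotProduct, Fin.sum_univ_four, Pi.zero_apply] at this
        have key : (T : Matrix (Fin 4) (Fin 4) K) 1 0 * v 0 = 0 := by
          linear_combination this - v 1 * hd 1 - v 2 * e12 - v 3 * e13
        exact (mul_eq_zero.1 key).resolve_right hi₀
      have r2 : (T : Matrix (Fin 4) (Fin 4) K) 2 0 = 0 := by
        have := congrFun hTv 2
        simp only [mulVec, dotProduct, Fin.sum_univ_four, Pi.zero_apply] at this
        have key : (T : Matrix (Fin 4) (Fin 4) K) 2 0 * v 0 = 0 := by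
          linear_combination this - v 1 * e21 - v 2 * hd 2 - v 3 * e23
        exact (mul_eq_zero.1 key).resolve_right hi₀
      have r3 : (T : Matrix (Fin 4) (Fin 4) K) 3 0 = 0 := by
        have := congrFun hTv 3
        simp only [mulVec, dotProduct, Fin.sum_univ_four, Pi.zero_apply] at this
        have key : (T : Matrix (Fin 4) (Fin 4) K) 3 0 * v 0 = 0 := by
          linear_combination this - v 1 * e31 - v 2 * e32 - v 3 * hd 3
        exact (mul_eq_zero.1 key).resolve_right hi₀
      have c1 : (T : Matrix (Fin 4) (Fin 4) K) 0 1 = 0 := by rw [sy]; exact r1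
      have c2 : (T : Matrix (Fin 4) (Fin 4) K) 0 2 = 0 := by rw [sy]; exact r2
      have c3 : (T : Matrix (Fin 4) (Fin 4) K) 0 3 = 0 := by rw [sy]; exact r3
      have d0 := hd 0; have d1 := hd 1; have d2 := hd 2; have d3 := hd 3
      apply Subtype.ext
      ext i j
      fin_cases i <;> fin_cases j <;> assumption
    have := LinearMap.finrank_le_finrank_of_injective hf
    simpa using this
  · -- `v 1 ≠ 0`: the entries `T 0 2, T 0 3, T 2 3` determine `T`
    let f : P →ₗ[K] (Fin 3 → K) :=
      { toFun := fun T => ![(T : Matrix (Fin 4) (Fin 4) K) 0 2, (T : Matrix (Fin 4) (Fin 4) K) 0 3, (T : Matrix (Fin 4) (Fin 4) K) 2 3]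
        map_add' := fun T T' => by ext i; fin_cases i <;> simp
        map_smul' := fun s T => by ext i; fin_cases i <;> simp }
    have hf : Function.Injective f := by
      rw [← LinearMap.ker_eq_bot, LinearMap.ker_eq_bot']
      intro T hT
      obtain ⟨hs, hd, hTv⟩ := hP T T.2
      have e12 : (T : Matrix (Fin 4) (Fin 4) K) 0 2 = 0 := by
        have := congrFun hT 0; simpa [f] using this
      have e13 : (T : Matrix (Fin 4) (Fin 4) K) 0 3 = 0 := by
        have := congrFun hT 1; simpa [f] using this
      have e23 : (T : Matrix (Fin 4) (Fin 4) K) 2 3 = 0 := by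
        have := congrFun hT 2; simpa [f] using this
      have sy : ∀ i j, (T : Matrix (Fin 4) (Fin 4) K) i j = (T : Matrix (Fin 4) (Fin 4) K) j i :=
        fun i j => by have := congrFun (congrFun hs j) i; simpa only [transpose_apply] using this
      have e21 : (T : Matrix (Fin 4) (Fin 4) K) 2 0 = 0 := by rw [sy]; exact e12
      have e31 : (T : Matrix (Fin 4) (Fin 4) K) 3 0 = 0 := by rw [sy]; exact e13
      have e32 : (T : Matrix (Fin 4) (Fin 4) K) 3 2 = 0 := by rw [sy]; exact e23
      have r1 : (T : Matrix (Fin 4) (Fin 4) K) 0 1 = 0 := by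
        have := congrFun hTv 0
        simp only [mulVec, dotProduct, Fin.sum_univ_four, Pi.zero_apply] at this
        have key : (T : Matrix (Fin 4) (Fin 4) K) 0 1 * v 1 = 0 := by
          linear_combination this - v 0 * hd 0 - v 2 * e12 - v 3 * e13
        exact (mul_eq_zero.1 key).resolve_right hi₀
      have r2 : (T : Matrix (Fin 4) (Fin 4) K) 2 1 = 0 := by
        have := congrFun hTv 2
        simp only [mulVec, dotProduct, Fin.sum_univ_four, Pi.zero_apply] at this
        have key : (T : Matrix (Fin 4) (Fin 4) K) 2 1 * v 1 = 0 := by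
          linear_combination this - v 0 * e21 - v 2 * hd 2 - v 3 * e23
        exact (mul_eq_zero.1 key).resolve_right hi₀
      have r3 : (T : Matrix (Fin 4) (Fin 4) K) 3 1 = 0 := by
        have := congrFun hTv 3
        simp only [mulVec, dotProduct, Fin.sum_univ_four, Pi.zero_apply] at this
        have key : (T : Matrix (Fin 4) (Fin 4) K) 3 1 * v 1 = 0 := by
          linear_combination this - v 0 * e31 - v 2 * e32 - v 3 * hd 3
        exact (mul_eq_zero.1 key).resolve_right hi₀
      have c1 : (T : Matrix (Fin 4) (Fin 4) K) 1 0 = 0 := by rw [sy]; exact r1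
      have c2 : (T : Matrix (Fin 4) (Fin 4) K) 1 2 = 0 := by rw [sy]; exact r2
      have c3 : (T : Matrix (Fin 4) (Fin 4) K) 1 3 = 0 := by rw [sy]; exact r3
      have d0 := hd 0; have d1 := hd 1; have d2 := hd 2; have d3 := hd 3
      apply Subtype.ext
      ext i j
      fin_cases i <;> fin_cases j <;> assumption
    have := LinearMap.finrank_le_finrank_of_injective hf
    simpa using this
  · -- `v 2 ≠ 0`: the entries `T 0 1, T 0 3, T 1 3` determine `T`
    let f : P →ₗ[K] (Fin 3 → K) :=
      { toFun := fun T => ![(T : Matrix (Fin 4) (Fin 4) K) 0 1, (T : Matrix (Fin 4) (Fin 4) K) 0 3, (T : Matrix (Fin 4) (Fin 4) K) 1 3]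
        map_add' := fun T T' => by ext i; fin_cases i <;> simp
        map_smul' := fun s T => by ext i; fin_cases i <;> simp }
    have hf : Function.Injective f := by
      rw [← LinearMap.ker_eq_bot, LinearMap.ker_eq_bot']
      intro T hT
      obtain ⟨hs, hd, hTv⟩ := hP T T.2
      have e12 : (T : Matrix (Fin 4) (Fin 4) K) 0 1 = 0 := by
        have := congrFun hT 0; simpa [f] using this
      have e13 : (T : Matrix (Fin 4) (Fin 4) K) 0 3 = 0 := by
        have := congrFun hT 1; simpa [f] using this
      have e23 : (T : Matrix (Fin 4) (Fin 4) K) 1 3 = 0 := by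
        have := congrFun hT 2; simpa [f] using this
      have sy : ∀ i j, (T : Matrix (Fin 4) (Fin 4) K) i j = (T : Matrix (Fin 4) (Fin 4) K) j i :=
        fun i j => by have := congrFun (congrFun hs j) i; simpa only [transpose_apply] using this
      have e21 : (T : Matrix (Fin 4) (Fin 4) K) 1 0 = 0 := by rw [sy]; exact e12
      have e31 : (T : Matrix (Fin 4) (Fin 4) K) 3 0 = 0 := by rw [sy]; exact e13
      have e32 : (T : Matrix (Fin 4) (Fin 4) K) 3 1 = 0 := by rw [sy]; exact e23
      have r1 : (T : Matrix (Fin 4) (Fin 4) K) 0 2 = 0 := by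
        have := congrFun hTv 0
        simp only [mulVec, dotProduct, Fin.sum_univ_four, Pi.zero_apply] at this
        have key : (T : Matrix (Fin 4) (Fin 4) K) 0 2 * v 2 = 0 := by
          linear_combination this - v 0 * hd 0 - v 1 * e12 - v 3 * e13
        exact (mul_eq_zero.1 key).resolve_right hi₀
      have r2 : (T : Matrix (Fin 4) (Fin 4) K) 1 2 = 0 := by
        have := congrFun hTv 1
        simp only [mulVec, dotProduct, Fin.sum_univ_four, Pi.zero_apply] at this
        have key : (T : Matrix (Fin 4) (Fin 4) K) 1 2 * v 2 = 0 := by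
          linear_combination this - v 0 * e21 - v 1 * hd 1 - v 3 * e23
        exact (mul_eq_zero.1 key).resolve_right hi₀
      have r3 : (T : Matrix (Fin 4) (Fin 4) K) 3 2 = 0 := by
        have := congrFun hTv 3
        simp only [mulVec, dotProduct, Fin.sum_univ_four, Pi.zero_apply] at this
        have key : (T : Matrix (Fin 4) (Fin 4) K) 3 2 * v 2 = 0 := by
          linear_combination this - v 0 * e31 - v 1 * e32 - v 3 * hd 3
        exact (mul_eq_zero.1 key).resolve_right hi₀
      have c1 : (T : Matrix (Fin 4) (Fin 4) K) 2 0 = 0 := by rw [sy]; exact r1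
      have c2 : (T : Matrix (Fin 4) (Fin 4) K) 2 1 = 0 := by rw [sy]; exact r2
      have c3 : (T : Matrix (Fin 4) (Fin 4) K) 2 3 = 0 := by rw [sy]; exact r3
      have d0 := hd 0; have d1 := hd 1; have d2 := hd 2; have d3 := hd 3
      apply Subtype.ext
      ext i j
      fin_cases i <;> fin_cases j <;> assumption
    have := LinearMap.finrank_le_finrank_of_injective hf
    simpa using this
  · -- `v 3 ≠ 0`: the entries `T 0 1, T 0 2, T 1 2` determine `T`
    let f : P →ₗ[K] (Fin 3 → K) :=
      { toFun := fun T => ![(T : Matrix (Fin 4) (Fin 4) K) 0 1, (T : Matrix (Fin 4) (Fin 4) K) 0 2, (T : Matrix (Fin 4) (Fin 4) K) 1 2]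
        map_add' := fun T T' => by ext i; fin_cases i <;> simp
        map_smul' := fun s T => by ext i; fin_cases i <;> simp }
    have hf : Function.Injective f := by
      rw [← LinearMap.ker_eq_bot, LinearMap.ker_eq_bot']
      intro T hT
      obtain ⟨hs, hd, hTv⟩ := hP T T.2
      have e12 : (T : Matrix (Fin 4) (Fin 4) K) 0 1 = 0 := by
        have := congrFun hT 0; simpa [f] using this
      have e13 : (T : Matrix (Fin 4) (Fin 4) K) 0 2 = 0 := by
        have := congrFun hT 1; simpa [f] using this
      have e23 : (T : Matrix (Fin 4) (Fin 4) K) 1 2 = 0 := by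
        have := congrFun hT 2; simpa [f] using this
      have sy : ∀ i j, (T : Matrix (Fin 4) (Fin 4) K) i j = (T : Matrix (Fin 4) (Fin 4) K) j i :=
        fun i j => by have := congrFun (congrFun hs j) i; simpa only [transpose_apply] using this
      have e21 : (T : Matrix (Fin 4) (Fin 4) K) 1 0 = 0 := by rw [sy]; exact e12
      have e31 : (T : Matrix (Fin 4) (Fin 4) K) 2 0 = 0 := by rw [sy]; exact e13
      have e32 : (T : Matrix (Fin 4) (Fin 4) K) 2 1 = 0 := by rw [sy]; exact e23
      have r1 : (T : Matrix (Fin 4) (Fin 4) K) 0 3 = 0 := by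
        have := congrFun hTv 0
        simp only [mulVec, dotProduct, Fin.sum_univ_four, Pi.zero_apply] at this
        have key : (T : Matrix (Fin 4) (Fin 4) K) 0 3 * v 3 = 0 := by
          linear_combination this - v 0 * hd 0 - v 1 * e12 - v 2 * e13
        exact (mul_eq_zero.1 key).resolve_right hi₀
      have r2 : (T : Matrix (Fin 4) (Fin 4) K) 1 3 = 0 := by
        have := congrFun hTv 1
        simp only [mulVec, dotProduct, Fin.sum_univ_four, Pi.zero_apply] at this
        have key : (T : Matrix (Fin 4) (Fin 4) K) 1 3 * v 3 = 0 := by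
          linear_combination this - v 0 * e21 - v 1 * hd 1 - v 2 * e23
        exact (mul_eq_zero.1 key).resolve_right hi₀
      have r3 : (T : Matrix (Fin 4) (Fin 4) K) 2 3 = 0 := by
        have := congrFun hTv 2
        simp only [mulVec, dotProduct, Fin.sum_univ_four, Pi.zero_apply] at this
        have key : (T : Matrix (Fin 4) (Fin 4) K) 2 3 * v 3 = 0 := by
          linear_combination this - v 0 * e31 - v 1 * e32 - v 2 * hd 2
        exact (mul_eq_zero.1 key).resolve_right hi₀
      have c1 : (T : Matrix (Fin 4) (Fin 4) K) 3 0 = 0 := by rw [sy]; exact r1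
      have c2 : (T : Matrix (Fin 4) (Fin 4) K) 3 1 = 0 := by rw [sy]; exact r2
      have c3 : (T : Matrix (Fin 4) (Fin 4) K) 3 2 = 0 := by rw [sy]; exact r3
      have d0 := hd 0; have d1 := hd 1; have d2 := hd 2; have d3 := hd 3
      apply Subtype.ext
      ext i j
      fin_cases i <;> fin_cases j <;> assumption
    have := LinearMap.finrank_le_finrank_of_injective hf
    simpa using this

/-- If `X w, X w'` are linearly independent then `X` has two linearly independent columns.
[folklore] -/
theorem exists_indep_cols (X : Matrix (Fin 4) (Fin 4) K) (w w' : Fin 4 → K)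
    (hw : LinearIndependent K ![X *ᵥ w, X *ᵥ w']) :
    ∃ b k, LinearIndependent K ![fun a => X a b, fun a => X a k] := by
  by_contra hcon
  push Not at hcon
  have expand : ∀ u : Fin 4 → K, X *ᵥ u = ∑ b, u b • (fun a => X a b) := by
    intro u; funext a; simp [mulVec, dotProduct, Finset.sum_apply, mul_comm]
  -- all columns lie on one line
  have line : ∃ x₀ : Fin 4 → K, ∀ b, ∃ c : K, (fun a => X a b) = c • x₀ := by
    by_cases hz : ∀ b, (fun a => X a b) = 0
    · exact ⟨0, fun b => ⟨0, by rw [hz b, zero_smul]⟩⟩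
    · push Not at hz
      obtain ⟨b₀, hb₀⟩ := hz
      refine ⟨fun a => X a b₀, fun b => ?_⟩
      have hdep := hcon b₀ b
      rw [LinearIndependent.pair_iff] at hdep
      push Not at hdep
      obtain ⟨s, t, hst, hst0⟩ := hdep
      by_cases ht : t = 0
      · exfalso
        rw [ht, zero_smul, add_zero] at hst
        rcases smul_eq_zero.1 hst with hs | hs
        · exact hst0 hs ht
        · exact hb₀ hs
      · refine ⟨-(s / t), ?_⟩
        have : t • (fun a => X a b) = -(s • fun a => X a b₀) := eq_neg_of_add_eq_zero_right hst
        calc (fun a => X a b) = t⁻¹ • (t • fun a => X a b) := by rw [smul_smul, inv_mul_cancel₀ ht, one_smul]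
          _ = -(s / t) • fun a => X a b₀ := by rw [this, smul_neg, smul_smul, div_eq_inv_mul, neg_smul]
  obtain ⟨x₀, hx₀⟩ := line
  choose c hc using hx₀
  have onl : ∀ u : Fin 4 → K, X *ᵥ u = (∑ b, u b * c b) • x₀ := by
    intro u
    rw [expand, Finset.sum_smul]
    exact Finset.sum_congr rfl fun b _ => by rw [hc b, smul_smul]
  rw [LinearIndependent.pair_iff] at hw
  set α := ∑ b, w b * c b with hα
  set α' := ∑ b, w' b * c b with hα'
  by_cases h1 : α = 0
  · have := hw 1 0 (by rw [onl w, ← hα, h1, zero_smul, smul_zero, zero_smul, add_zero])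
    exact one_ne_zero this.1
  · have key : α' • X *ᵥ w + (-α) • X *ᵥ w' = 0 := by
      rw [onl w, onl w', ← hα, ← hα', smul_smul, smul_smul, ← add_smul]
      have : α' * α + -α * α' = 0 := by ring
      rw [this, zero_smul]
    have := hw α' (-α) key
    exact h1 (neg_eq_zero.1 this.2)

/-- The symmetric zero-diagonal `4 × 4` matrices span at least `6` dimensions. [folklore] -/
theorem six_le_finrank_szd (P : Submodule K (Matrix (Fin 4) (Fin 4) K))
    (hP : ∀ T : Matrix (Fin 4) (Fin 4) K, Tᵀ = T → (∀ i, T i i = 0) → T ∈ P) :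
    6 ≤ finrank K P := by
  let M : (Fin 6 → K) → Matrix (Fin 4) (Fin 4) K := fun g =>
    !![0, g 0, g 1, g 2; g 0, 0, g 3, g 4; g 1, g 3, 0, g 5; g 2, g 4, g 5, 0]
  have hM : ∀ g, M g ∈ P := fun g => hP (M g)
    (by ext a l; fin_cases a <;> fin_cases l <;> simp [M]) (fun i => by fin_cases i <;> simp [M])
  let f : (Fin 6 → K) →ₗ[K] P :=
    { toFun := fun g => ⟨M g, hM g⟩
      map_add' := fun g g' => by
        apply Subtype.ext; ext a l; fin_cases a <;> fin_cases l <;> simp [M]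
      map_smul' := fun s g => by
        apply Subtype.ext; ext a l; fin_cases a <;> fin_cases l <;> simp [M] }
  have hf : Function.Injective f := by
    intro g g' hgg
    have e : ∀ a l, M g a l = M g' a l := fun a l => by
      have := congrArg (fun x : P => (x : Matrix (Fin 4) (Fin 4) K) a l) hgg
      exact this
    have e01 := e 0 1; have e02 := e 0 2; have e03 := e 0 3
    have e12 := e 1 2; have e13 := e 1 3; have e23 := e 2 3
    simp only [M, Matrix.of_apply, Matrix.cons_val', Matrix.cons_val_zero, Matrix.cons_val_one,
      Matrix.cons_val, Matrix.empty_val', Matrix.cons_val_fin_one] at e01 e02 e03 e12 e13 e23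
    clear e hgg hM f
    clear_value M
    funext i
    fin_cases i <;> assumption
  have := LinearMap.finrank_le_finrank_of_injective hf
  simpa using this

/-- The `4 × 4` matrices with antisymmetric off-diagonal part span at least `10` dimensions.
[folklore] -/
theorem ten_le_finrank_da (P : Submodule K (Matrix (Fin 4) (Fin 4) K))
    (hP : ∀ M : Matrix (Fin 4) (Fin 4) K, (∀ i j, i ≠ j → M i j + M j i = 0) → M ∈ P) :
    10 ≤ finrank K P := by
  let M : (Fin 10 → K) → Matrix (Fin 4) (Fin 4) K := fun g =>
    !![g 0, g 4, g 5, g 6; -g 4, g 1, g 7, g 8; -g 5, -g 7, g 2, g 9; -g 6, -g 8, -g 9, g 3]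
  have hM : ∀ g, M g ∈ P := fun g => hP (M g) fun i j hij => by
    fin_cases i <;> fin_cases j <;> first | exact absurd rfl hij | simp [M]
  let f : (Fin 10 → K) →ₗ[K] P :=
    { toFun := fun g => ⟨M g, hM g⟩
      map_add' := fun g g' => by
        apply Subtype.ext; ext a l; fin_cases a <;> fin_cases l <;> simp [M] <;> ring
      map_smul' := fun s g => by
        apply Subtype.ext; ext a l; fin_cases a <;> fin_cases l <;> simp [M] }
  have hf : Function.Injective f := by
    intro g g' hgg
    have e : ∀ a l, M g a l = M g' a l := fun a l => by
      have := congrArg (fun x : P => (x : Matrix (Fin 4) (Fin 4) K) a l) hgg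
      exact this
    have e00 := e 0 0; have e11 := e 1 1; have e22 := e 2 2; have e33 := e 3 3
    have e01 := e 0 1; have e02 := e 0 2; have e03 := e 0 3
    have e12 := e 1 2; have e13 := e 1 3; have e23 := e 2 3
    simp only [M, Matrix.of_apply, Matrix.cons_val', Matrix.cons_val_zero, Matrix.cons_val_one,
      Matrix.cons_val, Matrix.empty_val', Matrix.cons_val_fin_one] at e00 e11 e22 e33 e01 e02 e03
    simp only [M, Matrix.of_apply, Matrix.cons_val', Matrix.cons_val_zero, Matrix.cons_val_one,
      Matrix.cons_val, Matrix.empty_val', Matrix.cons_val_fin_one] at e12 e13 e23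
    clear e hgg hM f
    clear_value M
    funext i
    fin_cases i <;> assumption
  have := LinearMap.finrank_le_finrank_of_injective hf
  simpa using this

end Summit.ValiantsHypothesis.ValiantsHypothesis.Theorems.SymPencilPerFourPeeledFlatRankLemmas

end
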